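import Summits.BirchSwinnertonDyer.BirchSwinnertonDyer.Theorems.CyclotomicUntwistFormalEndomorphismVerschiebung
import Summits.BirchSwinnertonDyer.BirchSwinnertonDyer.Theorems.CyclotomicUntwistFormalEndomorphismPadicDigits
import Summits.BirchSwinnertonDyer.BirchSwinnertonDyer.Theorems.CyclotomicUntwistKatzRankSupersingular
import HarnessLib

/-!
# The Literature named fact `katz_dieudonne_rank_le_two` (Katz 1981 Thm 5.3.3 over `𝓞_{ℚ₃(ζ₉)}`) DISCHARGED —
# the elementary Katz-rank route of the `cycu` seats closed on EVERY good fibre (ordinary fibres: the inverse Verschiebung)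

Cell `pub/bsd-wall` (D-0145 line `route-BirchSwinnertonDyer-CyclotomicUntwist` rev 9), width seat `bsd-line-cycu-p5`
(gen 11), lane «ORDINARY FIBRES». THEOREMS ONLY (no definition, no named fact, no instance, no `sorry`); helper
`--supports` K1 = stmt-BirchSwinnertonDyer-21580 (serves K2 = 21581 and the print child C2 = 27549). BSD is not proved by
this file and no crux is: what becomes unconditional is the EXISTENCE of the descended Frobenius matrix (the print input
of C2's second conjunct); C2 itself keeps Gross–Zagier–Kolyvagin, and K1/K2 keep their research children C1/C4/C5.

THE CHAIN (all landed, all kernel): for `V/ℤ_p` with elliptic fibres (`p` odd),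
* W1 (cycu-p3, `SecondKindLog.exists_isPadicInt_formalLog_subst_eq`): a second-kind `g` has `pᵏ g = log_W(ψ)`, `ψ ∈ Xℤ_p⟦X⟧`;
* B1 (cycu-p1, `PadicRankTwoAssembly.map_toZMod_subst_formalGroupLaw` over cycu-p4's Lemma Λ): `ψ̄ ∈ End(F̄)`;
* ★ (cycu-p2, `FormalEndomorphismDigits.exists_digitExpansion` / `FormalEndomorphismPadicDigits.…_of_datum`): GIVEN a datum
  (SS) «`e ∈ End(F̄)`, `[p]‾(e) = X^{p²}`», every `H̄ ∈ End(F̄)` has digit expansions `F̄(F̄([a_J], [b_J](Xᵖ)), [pᴶ](g_J))`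
  with `a_J → A`, `b_J → B` in `ℤ_p`;
* (SS) on SUPERSINGULAR fibres (cycu-p2, `exists_hom_formalMul_subst_eq_X_pow_sq`) and on ORDINARY fibres (cycu-p5,
  `FormalEndomorphismVerschiebung.exists_hom_formalMul_subst_eq_X_pow_sq_of_not_dvd`: `e = V̄⁻¹(Xᵖ)`) — §1 below joins them;
* BRIDGE (cycu-p4, `PadicDigitLimit.padicRankTwo_of_honda_of_digits`): W1 + digits ⟹ `g ≡ a·log + b·log(Xᵖ)` mod bounded
  denominators (the `H3` body, §2 below: now on EVERY fibre);
* BASE CHANGE (cycu-p4, `KatzRankBaseChange.katz_dieudonne_rank_le_two_of_padicRankTwo`): `H3 → katz_dieudonne_rank_le_two`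
  (§3: **`katz_dieudonne_rank_le_two_holds`**);
* (the supersingular-only named fact `WeierstrassCurve.isDescendedFrobeniusMatrix_exists` is discharged separately by cycu-p2,
  `CyclotomicUntwistDescendedFrobeniusMatrixExistsHolds`).

References: [cite: Katz1981CrystallineDieudonne, Thm. 5.3.3, Thm. 5.7.2, (6.1.1)] · [cite: BerthelotOgus1983, Thm. (2.4), Prop. (3.14)]
· [cite: Honda1970, Thm. 2, Thm. 9] · [cite: SilvermanAEC2009, IV.4.4, IV.7.4, V.4.1(a)].
-/

set_option autoImplicit false
-- single-conjunct summit: `Summit.BirchSwinnertonDyer.BirchSwinnertonDyer.…` repeats the name by design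
set_option linter.dupNamespace false

noncomputable section

open PowerSeries Literature.NumberTheory.EllipticCurves
  Summit.BirchSwinnertonDyer.BirchSwinnertonDyer.Theorems

namespace Summit.BirchSwinnertonDyer.BirchSwinnertonDyer.Theorems.KatzRankAllFibres

/-! ## §1 The digit theorem on every fibre -/

section Padic

variable {p : ℕ} [hp : Fact p.Prime] (V : WeierstrassCurve ℤ_[p]) [hE : (V.map PadicInt.Coe.ringHom).IsElliptic]
  [hEt : (V.map PadicInt.toZMod).IsElliptic]

/-- **Digits on an ORDINARY fibre** (`p ∤ t`): every `H ∈ Xℤ_p⟦X⟧` whose reduction is an endomorphism of `F̄` has the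
finite-level digit expansions `H̄ = F̄(F̄([a_J], [b_J](Xᵖ)), [pᴶ](g_J))` with `a_J → A`, `b_J → B` in `ℤ_p` — cycu-p2's ★
fed with the ordinary datum `e = V̄⁻¹(Xᵖ)`. (In fact `b_J → 0` is possible here, `End(F̄) = ℤ_p`; not needed.)
[cite: Katz1981CrystallineDieudonne, §5.3] [cite: SilvermanAEC2009, V.4.1(a)] -/
theorem exists_digits_of_map_toZMod_hom_of_not_dvd
    (hnd : ¬ (p : ℤ) ∣ Literature.NumberTheory.EllipticCurves.HasseManin.tr (V.map PadicInt.toZMod))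
    (H : ℤ_[p]⟦X⟧) (hH0 : constantCoeff H = 0)
    (hH : (H.map PadicInt.toZMod).subst (V.map PadicInt.toZMod).formalGroupLaw =
      MvPowerSeries.subst ![(H.map PadicInt.toZMod).subst (MvPowerSeries.X 0 : MvPowerSeries (Fin 2) (ZMod p)),
        (H.map PadicInt.toZMod).subst (MvPowerSeries.X 1 : MvPowerSeries (Fin 2) (ZMod p))]
        (V.map PadicInt.toZMod).formalGroupLaw) :
    ∃ (A B : ℤ_[p]) (a b : ℕ → ℕ) (g : ℕ → (ZMod p)⟦X⟧), (∀ J, constantCoeff (g J) = 0) ∧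
      (∀ J, ‖((a J : ℤ_[p]) - A)‖ ≤ (p : ℝ) ^ (-(J : ℤ)) ∧ ‖((b J : ℤ_[p]) - B)‖ ≤ (p : ℝ) ^ (-(J : ℤ))) ∧
      ∀ J, H.map PadicInt.toZMod = MvPowerSeries.subst ![MvPowerSeries.subst ![(V.map PadicInt.toZMod).formalMul (a J),
          expand p hp.out.ne_zero ((V.map PadicInt.toZMod).formalMul (b J))] (V.map PadicInt.toZMod).formalGroupLaw,
        ((V.map PadicInt.toZMod).formalMul (p ^ J)).subst (g J)] (V.map PadicInt.toZMod).formalGroupLaw := by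
  obtain ⟨e, he0, he, hπ⟩ := FormalEndomorphismVerschiebung.exists_hom_formalMul_subst_eq_X_pow_sq_of_not_dvd V hnd
  obtain ⟨A, B, a, b, g, hg, hAB, hJ⟩ :=
    FormalEndomorphismPadicDigits.exists_digits_of_map_toZMod_hom_of_datum V he0 he hπ H hH0 hH
  exact ⟨A, B, a, b, g, fun J => (hg J).1, hAB, hJ⟩

/-- **Digits on EVERY good fibre** (supersingular: cycu-p2's `exists_digits_of_map_toZMod_hom`; ordinary: §1).
[cite: Katz1981CrystallineDieudonne, §5.3] -/
theorem exists_digits_of_map_toZMod_hom_all (H : ℤ_[p]⟦X⟧) (hH0 : constantCoeff H = 0)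
    (hH : (H.map PadicInt.toZMod).subst (V.map PadicInt.toZMod).formalGroupLaw =
      MvPowerSeries.subst ![(H.map PadicInt.toZMod).subst (MvPowerSeries.X 0 : MvPowerSeries (Fin 2) (ZMod p)),
        (H.map PadicInt.toZMod).subst (MvPowerSeries.X 1 : MvPowerSeries (Fin 2) (ZMod p))]
        (V.map PadicInt.toZMod).formalGroupLaw) :
    ∃ (A B : ℤ_[p]) (a b : ℕ → ℕ) (g : ℕ → (ZMod p)⟦X⟧), (∀ J, constantCoeff (g J) = 0) ∧
      (∀ J, ‖((a J : ℤ_[p]) - A)‖ ≤ (p : ℝ) ^ (-(J : ℤ)) ∧ ‖((b J : ℤ_[p]) - B)‖ ≤ (p : ℝ) ^ (-(J : ℤ))) ∧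
      ∀ J, H.map PadicInt.toZMod = MvPowerSeries.subst ![MvPowerSeries.subst ![(V.map PadicInt.toZMod).formalMul (a J),
          expand p hp.out.ne_zero ((V.map PadicInt.toZMod).formalMul (b J))] (V.map PadicInt.toZMod).formalGroupLaw,
        ((V.map PadicInt.toZMod).formalMul (p ^ J)).subst (g J)] (V.map PadicInt.toZMod).formalGroupLaw := by
  by_cases hdvd : (p : ℤ) ∣ Literature.NumberTheory.EllipticCurves.HasseManin.tr (V.map PadicInt.toZMod)
  · exact FormalEndomorphismPadicDigits.exists_digits_of_map_toZMod_hom V hdvd H hH0 hH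
  · exact exists_digits_of_map_toZMod_hom_of_not_dvd V hdvd H hH0 hH

/-! ## §2 Katz's rank `≤ 2` over `ℤ_p` on every fibre -/

/-- **`rank D(Ŵ/ℤ_p) ⊗ ℚ ≤ 2` ON EVERY GOOD FIBRE** (`p` odd): every second-kind `g ∈ Xℚ_p⟦X⟧` (log-type coefficients and
`F_W`-coboundary with `p`-power-bounded denominators) is `≡ a·log_W + b·log_W(Xᵖ)` modulo a series with `p`-power-bounded
denominators — W1 (cycu-p3) + digits on every fibre (§1) through cycu-p4's bridge. [cite: Katz1981CrystallineDieudonne, Thm. 5.3.3]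
[cite: Honda1970, Thm. 2] -/
theorem padicRankTwo (hp2 : p ≠ 2) :
    ∀ g : ℚ_[p]⟦X⟧, constantCoeff g = 0 →
      (∃ d : ℕ, ∀ n : ℕ, ‖(p : ℚ_[p]) ^ d * ((n : ℚ_[p]) * coeff n g)‖ ≤ 1) →
      (∃ d' : ℕ, ∀ e : Fin 2 →₀ ℕ, ‖(p : ℚ_[p]) ^ d' * MvPowerSeries.coeff e
        (g.subst (V.map PadicInt.Coe.ringHom).formalGroupLaw - g.subst (MvPowerSeries.X 0) -
          g.subst (MvPowerSeries.X 1))‖ ≤ 1) →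
      ∃ a b : ℚ_[p], ∃ d'' : ℕ, ∀ n : ℕ, ‖(p : ℚ_[p]) ^ d'' * coeff n
        (g - C a * (V.map PadicInt.Coe.ringHom).formalLog -
          C b * expand p hp.out.ne_zero (V.map PadicInt.Coe.ringHom).formalLog)‖ ≤ 1 := by
  refine PadicDigitLimit.padicRankTwo_of_honda_of_digits V hp2 ?_
    (fun H hH0 hH => exists_digits_of_map_toZMod_hom_all V H hH0 hH)
  intro g hg0 _ hd'
  obtain ⟨d', hSK⟩ := hd'
  obtain ⟨k, ψ, hψint, hψ0, hψ⟩ := SecondKindLog.exists_isPadicInt_formalLog_subst_eq V hg0 hSK hp2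
  exact ⟨k, ψ, hψ0, hψint, hψ⟩

end Padic

/-! ## §3 The named fact -/

section Three

/-- The `H3` binder of cycu-p4's base change, now a theorem: Katz's rank `≤ 2` over `ℤ₃` for EVERY `V₀/ℤ₃` with elliptic fibres.
[cite: Katz1981CrystallineDieudonne, Thm. 5.3.3] -/
theorem padicRankTwo_three :
    ∀ (V₀ : WeierstrassCurve ℤ_[3]) [(V₀.map PadicInt.Coe.ringHom).IsElliptic]
      [(V₀.map PadicInt.toZMod).IsElliptic] (g : ℚ_[3]⟦X⟧), constantCoeff g = 0 →
      (∃ d : ℕ, ∀ n : ℕ, ‖(3 : ℚ_[3]) ^ d * ((n : ℚ_[3]) * coeff n g)‖ ≤ 1) →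
      (∃ d' : ℕ, ∀ e : Fin 2 →₀ ℕ, ‖(3 : ℚ_[3]) ^ d' * MvPowerSeries.coeff e
        (g.subst (V₀.map PadicInt.Coe.ringHom).formalGroupLaw - g.subst (MvPowerSeries.X 0) -
          g.subst (MvPowerSeries.X 1))‖ ≤ 1) →
      ∃ (a b : ℚ_[3]) (d'' : ℕ), ∀ n : ℕ, ‖(3 : ℚ_[3]) ^ d'' * coeff n
        (g - PowerSeries.C a * (V₀.map PadicInt.Coe.ringHom).formalLog -
          PowerSeries.C b * expand 3 (by norm_num) (V₀.map PadicInt.Coe.ringHom).formalLog)‖ ≤ 1 := by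
  intro V₀ _ _ g hg0 hd hd'
  exact padicRankTwo V₀ (by norm_num) g hg0 hd hd'

/-- **THE LITERATURE NAMED FACT `katz_dieudonne_rank_le_two` HOLDS** (Katz 1981 Thm 5.3.3 in the tree's one-model shape over
`𝓞 = 𝓞_{ℚ₃(ζ₉)}`: any three second-kind series of a Weierstrass equation over `𝓞` with elliptic special fibre are
`ℚ₃(ζ₉)`-dependent modulo bounded denominators) — by cycu-p4's base change from `ℤ₃` (§2 on every fibre). Elementary
throughout (Honda's functional equation, the endomorphisms of the reduced formal group, `3`-adic limits); no crystalline input.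
[cite: Katz1981CrystallineDieudonne, Thm. 5.3.3] -/
theorem _root_.Literature.NumberTheory.EllipticCurves.katz_dieudonne_rank_le_two_holds :
    Literature.NumberTheory.EllipticCurves.katz_dieudonne_rank_le_two :=
  KatzRankBaseChange.katz_dieudonne_rank_le_two_of_padicRankTwo padicRankTwo_three

/-! `WeierstrassCurve.isDescendedFrobeniusMatrix_exists_holds` (the second named fact, which needs only SUPERSINGULAR
fibres) is already landed by cycu-p2 as `FormalEndomorphismPadicDigits.isDescendedFrobeniusMatrix_exists_holds`
(`Theorems/CyclotomicUntwistDescendedFrobeniusMatrixExistsHolds.lean`); not restated here. -/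

end Three

end Summit.BirchSwinnertonDyer.BirchSwinnertonDyer.Theorems.KatzRankAllFibres

end
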